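import Summits.Ventures.HodgeRepro.BallGenJacobian
import Summits.Ventures.HodgeRepro.BallGenInvariance
import Summits.Ventures.HodgeRepro.BallDominance

/-!
# Lemma W, submersion and dominance for `g ≤ p` forms (seat p5)

Blind re-derivation cell `pub-hodge-repro`, seat `p5`.  ROUTE-C R5 applies Lemma W to `g′ = dim A′ ≤ p` pulled-back
eigenforms on the `p`-ball (`p = max(3k, g)` or `3g`, so in general `g′ < p`).  typer-2's `lemmaW_iter` is stated
for `g ≤ p` forms, but the generic (open dense) form `lemmaW_generic` and p5's `exists_submersion_on_dense` /
`lemmaW_submersion_congruenceCover_ratPointsOf` / `lemmaW_dominance_congruenceCover_ratPointsOf` take exactly `p`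
forms.  This file removes the restriction: `g ≤ p` forms are PADDED with `p − g` constant covector fields
(the all-ones covector, non-zero since `p > 0`), `lemmaW_generic` is applied to the padded family, and the
first `g` translated covectors of an independent family are independent.  The invariance clause for `g < p`
forms is stated per translate (`γ_l^*ω_l` is `Γ″`-invariant for every `l` — stronger than the top-form
clause used at `g = p`).

* `lemmaW_generic_le` — `g ≤ p` analytic fields, none identically zero on the ball, dense `Δ ≤ U(p,1)` ⇒
  translates `γ_1, …, γ_g ∈ Δ` and an open dense set of points where `(γ_l^*F_l)(z)` are independent;
* `exists_submersion_on_dense_le` — R5 steps (2)+(4), local form: `g ≤ p` functions `h_l` analytic near the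
  ball, none locally constant on it ⇒ `γ_l ∈ Δ` and an open dense set on which `w ↦ (h_l(γ_l w))_{l<g}` is a
  submersion;
* `exists_dominance_le` — the global form: every entire `H : ℂ^g → ℂ` vanishing on the image of the ball
  under `w ↦ (h_l(γ_l w))_{l<g}` is `0` (`f(S′)` in no theta-divisor of `A′ = ℂ^g/Λ`: Zariski dense);
* `isInvariant_pullback_inf_iInf` — `Γ`-invariant `ω_l` ⇒ each translate `γ_l^*ω_l` is
  `Γ ⊓ ⨅_l γ_l⁻¹Γγ_l`-invariant.

Nothing here says anything about the status of the Hodge conjecture for CM abelian varieties.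
-/

set_option autoImplicit false

noncomputable section

namespace HodgeRepro.BallGen

namespace LE

open Filter Topology
open Holo Subm Jacob Inv Dom

variable {p : ℕ}

/-- **Lemma W, generic form, `g ≤ p` forms.**  For a dense subgroup `Δ ≤ U(p,1)` and `g ≤ p` analytic fields
`F_1, …, F_g` on the ball, none identically zero there, some `γ_1, …, γ_g ∈ Δ` make the translated covectors
`(γ_l^*F_l)(z)` linearly independent at every point of an open dense subset of `𝔹^p`. -/
theorem lemmaW_generic_le {g : ℕ} (hg : g ≤ p) {Δ : Subgroup (U p)} (hΔ : Dense (Δ : Set (U p)))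
    {F : Fin g → (Fin p → ℂ) → (Fin p → ℂ)} (hF : ∀ i, AnalyticOnNhd ℂ (F i) (ballSet p))
    (hF0 : ∀ i, ∃ w : Ball p, F i w.1 ≠ 0) :
    ∃ γ : Fin g → U p, (∀ i, γ i ∈ Δ) ∧ ∃ S : Set (Ball p), IsOpen S ∧ Dense S ∧
      ∀ z ∈ S, LinearIndependent ℂ fun i => pullback (γ i) (fun w : Ball p => F i w.1) z := by
  rcases Nat.eq_zero_or_pos g with rfl | hg0
  · exact ⟨fun i => Fin.elim0 i, fun i => Fin.elim0 i, Set.univ, isOpen_univ, dense_univ,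
      fun _ _ => linearIndependent_empty_type⟩
  have hp : 0 < p := lt_of_lt_of_le hg0 hg
  -- pad with the constant all-ones covector field
  set F' : Fin p → (Fin p → ℂ) → (Fin p → ℂ) :=
    fun j => if h : (j : ℕ) < g then F ⟨j, h⟩ else fun _ _ => 1 with hF'
  have hFF : ∀ i : Fin g, F' (Fin.castLE hg i) = F i := by
    intro i
    simp only [hF', Fin.val_castLE, i.isLt, dif_pos, Fin.eta]
  have hF'a : ∀ j, AnalyticOnNhd ℂ (F' j) (ballSet p) := by
    intro j
    simp only [hF']
    split_ifs with h
    · exact hF ⟨j, h⟩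
    · exact analyticOnNhd_const
  have hF'0 : ∀ j, ∃ w : Ball p, F' j w.1 ≠ 0 := by
    intro j
    simp only [hF']
    split_ifs with h
    · exact hF0 ⟨j, h⟩
    · refine ⟨center p, fun h1 => ?_⟩
      have := congrFun h1 ⟨0, hp⟩
      simp at this
  obtain ⟨γ', hγ', hopen, hdense⟩ := lemmaW_generic hΔ hF'a hF'0
  refine ⟨fun i => γ' (Fin.castLE hg i), fun i => hγ' _, _, hopen, hdense, fun z hz => ?_⟩
  have hz' : LinearIndependent ℂ fun j => pullback (γ' j) (fun w : Ball p => F' j w.1) z := hz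
  have hsub := hz'.comp (Fin.castLE hg) (Fin.castLE_injective hg)
  convert hsub using 1
  funext i
  simp only [Function.comp, hFF]

/-- **R5 steps (2)+(4), local form, `g ≤ p` functions.**  For a dense `Δ ≤ U(p,1)` and `g ≤ p` functions
`h_1, …, h_g` analytic on a neighbourhood of the ball, none locally constant on it, there are
`γ_1, …, γ_g ∈ Δ` and an open dense set of points `z` of the ball at each of which `w ↦ (h_l(γ_l w))_{l<g}`
is a submersion: it maps every neighbourhood of `z` onto a neighbourhood of its value. -/
theorem exists_submersion_on_dense_le {g : ℕ} (hg : g ≤ p) {Δ : Subgroup (U p)}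
    (hΔ : Dense (Δ : Set (U p))) {h : Fin g → (Fin p → ℂ) → ℂ}
    (hh : ∀ l, AnalyticOnNhd ℂ (h l) (ballSet p)) (hh0 : ∀ l, ∃ w : Ball p, dcov (h l) w.1 ≠ 0) :
    ∃ γ : Fin g → U p, (∀ l, γ l ∈ Δ) ∧ ∃ S : Set (Ball p), IsOpen S ∧ Dense S ∧
      ∀ z ∈ S, ∀ U ∈ 𝓝 z.1,
        (fun w l => h l (actE (γ l) w)) '' U ∈ 𝓝 fun l => h l (actE (γ l) z.1) := by
  have hF : ∀ l, AnalyticOnNhd ℂ (fun w => dcov (h l) w) (ballSet p) := fun l => analyticOnNhd_dcov (hh l)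
  obtain ⟨γ, hγ, S, hSo, hSd, hli⟩ := lemmaW_generic_le hg hΔ hF hh0
  refine ⟨γ, hγ, S, hSo, hSd, fun z hz U hU => ?_⟩
  exact image_mem_nhds_of_linearIndependent_pullback_dcov h γ z
    (fun l => hh l _ (actE_mem_ballSet (γ l) z.2)) (hli z hz) hU

/-- **R5 step (4), global form, `g ≤ p` functions (dominance).**  Under the hypotheses of
`exists_submersion_on_dense_le` there are `γ_1, …, γ_g ∈ Δ` such that every entire function `H : ℂ^g → ℂ`
vanishing at every point `(h_l(γ_l w))_{l<g}`, `w ∈ 𝔹^p`, is identically zero — the image of the ball is a set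
of uniqueness: for `A′ = ℂ^g/Λ`, `f(S′)` lies in the zero locus of no non-zero theta function, i.e. in no
divisor of `A′` (Zariski dense). -/
theorem exists_dominance_le {g : ℕ} (hg : g ≤ p) {Δ : Subgroup (U p)} (hΔ : Dense (Δ : Set (U p)))
    {h : Fin g → (Fin p → ℂ) → ℂ} (hh : ∀ l, AnalyticOnNhd ℂ (h l) (ballSet p))
    (hh0 : ∀ l, ∃ w : Ball p, dcov (h l) w.1 ≠ 0) :
    ∃ γ : Fin g → U p, (∀ l, γ l ∈ Δ) ∧
      ∀ H : (Fin g → ℂ) → ℂ, AnalyticOnNhd ℂ H Set.univ →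
        (∀ w ∈ ballSet p, H (fun l => h l (actE (γ l) w)) = 0) → H = 0 := by
  obtain ⟨γ, hγ, S, _, hSd, hsub⟩ := exists_submersion_on_dense_le hg hΔ hh hh0
  refine ⟨γ, hγ, fun H hH h0 => ?_⟩
  haveI : Nonempty (Ball p) := ⟨center p⟩
  obtain ⟨z, hz⟩ := hSd.nonempty
  exact eq_zero_of_eqOn_image_of_mem_nhds
    (hsub z hz (ballSet p) (isOpen_ballSet.mem_nhds (val_mem_ballSet z))) hH h0

/-- **Per-translate invariance.**  If every `ω_l` is `Γ`-invariant then each translate `γ_l^*ω_l` is invariant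
under `Γ″ = Γ ⊓ ⨅_l γ_l⁻¹ Γ γ_l` (the form of the A4 bookkeeping that makes sense for `g < p` forms, where
there is no top form). -/
theorem isInvariant_pullback_inf_iInf {Γ : Subgroup (U p)} {ι : Type} {ω : ι → Ball p → Fin p → ℂ}
    (hω : ∀ l, IsInvariant Γ (ω l)) (γ : ι → U p) (l : ι) :
    IsInvariant (Γ ⊓ ⨅ l, conjSub (γ l) Γ) (pullback (γ l) (ω l)) :=
  (isInvariant_pullback_conj (hω l) (γ l)).mono (inf_le_right.trans (iInf_le _ l))

end LE

end HodgeRepro.BallGen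

end
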